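import Summits.NavierStokesRegularity.NavierStokesRegularity.Theorems.TypeIliouvilleNoTypeII.Negative.NSISuperCascadePowerZoomable
import Literature.Analysis.FluidPDE.NormalisedPressureSupBound
import Literature.Analysis.FluidPDE.NormalisedPressureLpBoundProofs
import HarnessLib

/-!
# The super-similar NSI cascade satisfies Seregin's pressure gauge `r^{2ρ} D`

Negative-lane support file for `stmt-NavierStokesRegularity-0056` (kill-kit, model class M2′),
completing the power-gauge hypothesis (G3) of the §B route `EulerZoomLiouville`
(`TypeIOrPowerZoomable`, `SereginZoomReduction`; Seregin, arXiv:2402.13229, (1.7)) for the NSI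
cascade: after `r^{2ρ} A` and `r^{ρ} E` (`NSISuperCascadePowerGauges`) we bound the pressure gauge
`D(r; z₀) = r^{-2} ∫∫_{Q_r(z₀)} |p|^{3/2}` of the cascade's pressure `p(s) = p̃[𝔲(s)]`:

* `exists_lintegral_cylinder_pressure_le` — `∫∫_{ℝ × B(x',r)} |p̃[𝔲]|^{3/2} ≤ C r^{2-2ρ}`;
* `exists_powerGaugeD_le` — `r^{2ρ} · cknD r z₀ p̃[𝔲] ≤ C` at every centre and scale;
* `exists_powerGauges_le` — the full bound `r^{2ρ}A + r^{ρ}E + r^{2ρ}D ≤ M` of (G3), all `r > 0`.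

Mechanism: on the `j`-th strip `p̃[𝔲(s)] = a^{2j} p̃[u(s')] ∘ Γ^{-j}` (`normalisedPressure_pieceG`),
so the strip carries `(a²τ⁴)ʲ P = (τʲ)^{2-2ρ} P` with `P = ∫₀ᵀ∫|p̃[u]|^{3/2} < ∞` (Calderón–Zygmund,
`stein1970_normalisedPressure_Lp_bound_holds`, uniformly in the slice), while
`|p̃[𝔲]| ≤ a^{2j} sup|p̃[u]|` (`abs_normalisedPressure_le_of_bounds`) gives the volume count
`T σ^{2j} |B_r| (a^{2j})^{3/2} = C r³ (τʲ)^{-(1+2ρ)}`; `crossover_tsum_le` with exponents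
`(2-2ρ, 1+2ρ)`. WHAT THIS IS NOT: nothing about NS/Euler solutions; no new definitions.

References: Seregin, arXiv:2402.13229 (2024), (1.7); Ożański, arXiv:1709.00602 (2017), §2
[`Ozanski2017NSISingular`]; Stein 1970, Ch. II §4 [`Stein1971`]; CKN 1982, (2.5).
-/

noncomputable section

open MeasureTheory Set Function Filter Topology Metric Module
open scoped ENNReal

set_option linter.dupNamespace false

namespace Summit.NavierStokesRegularity.NavierStokesRegularity.Theorems.TypeIliouvilleNoTypeIINegative

open Literature.Analysis.FluidPDE Literature.Barriers.NavierStokesRegularity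
open Literature.Barriers.NavierStokesRegularity.Scheffer TopologicalSpace

namespace IsSuperBlock

variable {T ν₀ τ σ a : ℝ} {z : EuclideanSpace ℝ (Fin 3)} {G : Set (EuclideanSpace ℝ (Fin 3))}
  {u : ℝ → EuclideanSpace ℝ (Fin 3) → EuclideanSpace ℝ (Fin 3)} {ρ : ℝ}

/-! ### Uniform bounds for the block: `‖Du‖`, `|p̃[u]|` -/

/-- A uniform bound for `‖Du‖` on `[0,T] × ℝ³`. [folklore] -/
theorem exists_bound_norm_fderiv (h : IsSuperBlock T ν₀ τ σ a z G u) :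
    ∃ M : ℝ, 0 ≤ M ∧ ∀ t ∈ Icc 0 T, ∀ x, ‖fderiv ℝ (u t) x‖ ≤ M := by
  obtain ⟨M, hM⟩ := (isCompact_Icc.prod h.isCompact).exists_bound_of_continuousOn
    (h.block.continuousOn_fderiv_slice.mono (prod_mono Subset.rfl (subset_univ _)))
  refine ⟨max M 0, le_max_right _ _, fun t ht x => ?_⟩
  by_cases hx : x ∈ G
  · exact (hM (t, x) (mk_mem_prod ht hx)).trans (le_max_left _ _)
  · rw [h.block.fderiv_slice_eq_zero_of_notMem ht hx, norm_zero]
    exact le_max_right _ _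

/-- **A uniform bound for the pressure of the block**: `|p̃[u(s)](y)| ≤ M` for `s ∈ [0,T]` and all
`y` (Stein's pointwise bound `abs_normalisedPressure_le_of_bounds` with the uniform bounds on
`|u|`, `‖Du‖` and the energy `∫|u(s)|² ≤ ∫|u(0)|²`). [cite: Stein1971, Ch. II §4] -/
theorem exists_bound_pressure (h : IsSuperBlock T ν₀ τ σ a z G u) :
    ∃ M : ℝ, 0 ≤ M ∧ ∀ s ∈ Icc 0 T, ∀ y, ‖normalisedPressure (u s) y‖ ≤ M := by
  obtain ⟨M₀, hM₀0, hM₀⟩ := h.block.exists_bound_norm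
  obtain ⟨M₁, hM₁0, hM₁⟩ := h.exists_bound_norm_fderiv
  set E₀ : ℝ := ∫ y, ‖u 0 y‖ ^ 2 with hE₀
  have hE₀0 : 0 ≤ E₀ := integral_nonneg fun y => sq_nonneg _
  refine ⟨M₀ ^ 2 / 3 + 8 * M₀ * M₁ + E₀ / (2 * Real.pi), by positivity, fun s hs y => ?_⟩
  have h1 := abs_normalisedPressure_le_of_bounds
    ((h.block.contDiff_slice hs).of_le (by norm_cast))
    (by rw [nsiBlock_lintegral_enorm_sq_eq h.block hs]; exact ENNReal.ofReal_lt_top)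
    (hM₀ s hs) (hM₁ s hs) y
  rw [Real.norm_eq_abs]
  have h2 : (∫ x, ‖u s x‖ ^ 2) / (2 * Real.pi) ≤ E₀ / (2 * Real.pi) :=
    div_le_div_of_nonneg_right (nsiBlock_integral_norm_sq_le h.block hs) (by positivity)
  linarith

/-! ### The pressure of the cascade on the strips -/

/-- On the `j`-th strip, `p̃[𝔲(s)](x) = a^{2j} p̃[u](Φⱼ(s,x))`. [cite: Ozanski2017NSISingular, §2 (2.4)] -/
theorem pressure_glueG_eq_smul_stPull (h : IsSuperBlock T ν₀ τ σ a z G u) {j : ℕ} {s : ℝ}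
    (hs : s ∈ Ico (switchTime T σ j) (switchTime T σ (j + 1))) (x : EuclideanSpace ℝ (Fin 3)) :
    normalisedPressure (glueG T σ τ a z u s) x =
      (((a ^ j) ^ 2) • stPull ((σ⁻¹) ^ (2 * j)) ((τ⁻¹) ^ j)
        (-((σ⁻¹) ^ (2 * j) * switchTime T σ j)) ((1 - (τ⁻¹) ^ j) • (1 - τ)⁻¹ • z)
        (fun r y => normalisedPressure (u r) y)) s x := by
  rw [glueG_eq_pieceG h.T_pos h.σ_pos τ a z u hs, h.normalisedPressure_pieceG j s x]
  rfl

/-- **Size of the pressure on the `j`-th piece**: `|p̃[𝔲(t)](x)| ≤ a^{2j} sup|p̃[u]|`.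
[cite: Ozanski2017NSISingular, §2.1 (p. 6)] -/
theorem norm_pressure_glueG_le_of_mem (h : IsSuperBlock T ν₀ τ σ a z G u) {Mp : ℝ}
    (hMp : ∀ s ∈ Icc 0 T, ∀ y, ‖normalisedPressure (u s) y‖ ≤ Mp) {t : ℝ} {j : ℕ}
    (hj : t ∈ Ico (switchTime T σ j) (switchTime T σ (j + 1))) (x : EuclideanSpace ℝ (Fin 3)) :
    ‖normalisedPressure (glueG T σ τ a z u t) x‖ ≤ (a ^ j) ^ 2 * Mp := by
  rw [glueG_eq_pieceG h.T_pos h.σ_pos τ a z u hj, h.normalisedPressure_pieceG j t x, norm_mul,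
    Real.norm_of_nonneg (sq_nonneg _)]
  exact mul_le_mul_of_nonneg_left (hMp _ (h.localTime_mem (Ico_subset_Icc_self hj)) _) (sq_nonneg _)

/-- **Strip integral of powers of the pressure**:
`∫⁻_{[t_j,t_{j+1}) × ℝ³} |p̃[𝔲]|^r = (a^{2j})^r (a⁻¹τ⁴)ʲ ∫⁻_{[0,T) × ℝ³} |p̃[u]|^r`.
[cite: Scheffer1985, proof of Lemma 2.3 (2.34)] -/
theorem setLIntegral_strip_enorm_pressure_rpow (h : IsSuperBlock T ν₀ τ σ a z G u) (j : ℕ)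
    {r : ℝ} (hr : 0 ≤ r) :
    ∫⁻ q in Ico (switchTime T σ j) (switchTime T σ (j + 1)) ×ˢ (univ : Set (EuclideanSpace ℝ (Fin 3))),
        ‖normalisedPressure (glueG T σ τ a z u q.1) q.2‖ₑ ^ r =
      ENNReal.ofReal (((a ^ j) ^ 2) ^ r * (a⁻¹ * τ ^ 4) ^ j) *
        ∫⁻ q in Ico 0 T ×ˢ (univ : Set (EuclideanSpace ℝ (Fin 3))),
          ‖normalisedPressure (u q.1) q.2‖ₑ ^ r := by
  rw [setLIntegral_congr_fun (measurableSet_Ico.prod MeasurableSet.univ)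
    (fun q hq => by rw [h.pressure_glueG_eq_smul_stPull (mem_prod.1 hq).1 q.2]),
    ← h.preimage_stAffine_eq_strip j,
    setLIntegral_enorm_rpow_stRescale (h.inv_σ_pow_pos _) (h.inv_tau_pow_pos _) _ _ _ _ _ hr,
    h.jacobian_eq, Real.enorm_eq_ofReal (sq_nonneg _), ENNReal.ofReal_rpow_of_nonneg (sq_nonneg _) hr,
    ← ENNReal.ofReal_mul (Real.rpow_nonneg (sq_nonneg _) _)]

/-- `(a^{2j})^{3/2} = a^{3j}`. [folklore] -/
theorem gain_pow_sq_rpow_three_halves (h : IsSuperBlock T ν₀ τ σ a z G u) (j : ℕ) :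
    ((a ^ j) ^ 2) ^ (3 / 2 : ℝ) = (a ^ j) ^ 3 := by
  rw [← Real.rpow_natCast (a ^ j) 2, ← Real.rpow_mul (h.gain_pow_pos j).le,
    show ((2 : ℕ) : ℝ) * (3 / 2) = ((3 : ℕ) : ℝ) by norm_num, Real.rpow_natCast]

/-- The dictionary entry `a²τ = τ^{-(1+2ρ)}`. [folklore] -/
theorem gain_sq_mul_eq_rpow (h : IsSuperBlock T ν₀ τ σ a z G u) (hρ : a = τ ^ (-(1 + ρ))) :
    a ^ 2 * τ = τ ^ (-(1 + 2 * ρ)) := by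
  have hτ := h.τ_pos
  rw [hρ, sq, ← Real.rpow_add hτ, ← Real.rpow_one τ, ← Real.rpow_mul hτ.le, ← Real.rpow_mul hτ.le,
    ← Real.rpow_add hτ]
  congr 1; ring

/-! ### The base pressure mass `P = ∫₀ᵀ∫ |p̃[u]|^{3/2}` is finite (Calderón–Zygmund) -/

/-- **`∫₀ᵀ∫_{ℝ³} |p̃[u]|^{3/2} < ∞`**: by Stein's `L^{3/2}` bound
(`stein1970_normalisedPressure_Lp_bound_holds`) `‖p̃[u(s)]‖_{3/2} ≤ C ‖|u(s)|²‖_{3/2} ≤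
C sup|u|² |G|^{2/3}` uniformly in `s ∈ [0,T]`, and Tonelli on the strip (the integrand is jointly
continuous there, `continuousOn_normalisedPressure`). [cite: Stein1971, Ch. II §4] -/
theorem base_lintegral_pressure_rpow_lt_top (h : IsSuperBlock T ν₀ τ σ a z G u) :
    ∫⁻ q in Ico 0 T ×ˢ (univ : Set (EuclideanSpace ℝ (Fin 3))),
        ‖normalisedPressure (u q.1) q.2‖ₑ ^ (3 / 2 : ℝ) < ⊤ := by
  obtain ⟨M₀, hM₀0, hM₀⟩ := h.block.exists_bound_norm
  have h32c : (3 / 2 : ℝ≥0∞) = ((3 / 2 : NNReal) : ℝ≥0∞) := by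
    rw [ENNReal.coe_div (by norm_num)]; norm_num
  have h1 : (1 : ℝ≥0∞) < 3 / 2 := by
    rw [h32c]; exact_mod_cast (by norm_num : (1 : NNReal) < 3 / 2)
  have htop : (3 / 2 : ℝ≥0∞) ≠ ⊤ := by rw [h32c]; exact ENNReal.coe_ne_top
  have h0 : (3 / 2 : ℝ≥0∞) ≠ 0 := (zero_lt_one.trans h1).ne'
  obtain ⟨Cz, hCz⟩ := stein1970_normalisedPressure_Lp_bound_holds (3 / 2 : ℝ≥0∞) h1 htop.lt_top
  have hGm : MeasurableSet G := h.isCompact.measurableSet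
  have hGtop : volume G ≠ ⊤ := h.isCompact.measure_lt_top.ne
  -- the uniform slice bound
  set B : ℝ≥0∞ := ((Cz : ℝ≥0∞) * (‖M₀ ^ 2‖ₑ * volume G ^ (1 / (3 / 2 : ℝ≥0∞).toReal))) ^ (3 / 2 : ℝ)
    with hB
  have hBtop : B ≠ ⊤ :=
    ENNReal.rpow_ne_top_of_nonneg (by norm_num) (ENNReal.mul_ne_top ENNReal.coe_ne_top
      (ENNReal.mul_ne_top enorm_ne_top (ENNReal.rpow_ne_top_of_nonneg (by positivity) hGtop)))
  have hslice : ∀ s ∈ Icc (0 : ℝ) T,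
      ∫⁻ y, ‖normalisedPressure (u s) y‖ₑ ^ (3 / 2 : ℝ) ≤ B := by
    intro s hs
    have h32 : (3 / 2 : ℝ≥0∞).toReal = 3 / 2 := by
      rw [ENNReal.toReal_div]; norm_num
    have e : ∫⁻ y, ‖normalisedPressure (u s) y‖ₑ ^ (3 / 2 : ℝ) =
        eLpNorm (normalisedPressure (u s)) (3 / 2 : ℝ≥0∞) volume ^ (3 / 2 : ℝ) := by
      rw [eLpNorm_eq_lintegral_rpow_enorm_toReal h0 htop, h32,
        ← ENNReal.rpow_mul, one_div, inv_mul_cancel₀ (by norm_num : (3 / 2 : ℝ) ≠ 0),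
        ENNReal.rpow_one]
    rw [e, hB]
    refine ENNReal.rpow_le_rpow ((hCz (u s) (h.block.contDiff_slice hs)
      (h.block.hasCompactSupport_slice hs)).trans ?_) (by norm_num)
    gcongr
    rw [← eLpNorm_indicator_const hGm h0 htop]
    refine eLpNorm_mono fun y => ?_
    by_cases hy : y ∈ G
    · rw [indicator_of_mem hy, Real.norm_of_nonneg (sq_nonneg _), Real.norm_of_nonneg (sq_nonneg _)]
      exact pow_le_pow_left₀ (norm_nonneg _) (hM₀ s hs y) 2
    · rw [indicator_of_notMem hy, h.block.apply_eq_zero_of_notMem hs hy]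
      simp
  -- Tonelli on the strip
  set F : ℝ × EuclideanSpace ℝ (Fin 3) → ℝ≥0∞ := fun q =>
    ‖normalisedPressure (u q.1) q.2‖ₑ ^ (3 / 2 : ℝ) with hF
  have hμ : (volume : Measure (ℝ × EuclideanSpace ℝ (Fin 3))).restrict
      (Ico 0 T ×ˢ (univ : Set (EuclideanSpace ℝ (Fin 3)))) =
      ((volume : Measure ℝ).restrict (Ico 0 T)).prod volume := by
    rw [Measure.restrict_prod_eq_prod_univ, ← Measure.volume_eq_prod]
  have hFm : AEMeasurable F (((volume : Measure ℝ).restrict (Ico 0 T)).prod volume) := by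
    rw [← hμ]
    have hc : ContinuousOn (fun q : ℝ × EuclideanSpace ℝ (Fin 3) => normalisedPressure (u q.1) q.2)
        (Ico 0 T ×ˢ univ) :=
      h.block.continuousOn_normalisedPressure.mono (prod_mono Ico_subset_Icc_self Subset.rfl)
    exact ENNReal.continuous_rpow_const.measurable.comp_aemeasurable
      (hc.aemeasurable (measurableSet_Ico.prod MeasurableSet.univ)).enorm
  change ∫⁻ q, F q ∂((volume : Measure (ℝ × EuclideanSpace ℝ (Fin 3))).restrict (Ico 0 T ×ˢ univ)) < ⊤
  rw [hμ, lintegral_prod _ hFm]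
  have hae : ∀ᵐ s ∂((volume : Measure ℝ).restrict (Ico 0 T)), ∫⁻ y, F (s, y) ≤ B :=
    (ae_restrict_iff' measurableSet_Ico).2 (Eventually.of_forall fun s hs =>
      hslice s (Ico_subset_Icc_self hs))
  calc ∫⁻ s, (∫⁻ y, F (s, y)) ∂((volume : Measure ℝ).restrict (Ico 0 T))
      ≤ ∫⁻ _, B ∂((volume : Measure ℝ).restrict (Ico 0 T)) := lintegral_mono_ae hae
    _ = B * volume (Ico (0 : ℝ) T) := by rw [lintegral_const, Measure.restrict_apply_univ]
    _ < ⊤ := ENNReal.mul_lt_top hBtop.lt_top (by rw [Real.volume_Ico]; exact ENNReal.ofReal_lt_top)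

/-! ### The `D`-gauge: `∫∫_{ℝ × B(x',r)} |p̃[𝔲]|^{3/2} ≤ C r^{2-2ρ}` -/

/-- **Pressure mass of the cascade near a point, in Seregin's class**: there is `C` with
`∫⁻_{ℝ × B(x',r)} |p̃[𝔲]|^{3/2} ≤ C r^{2-2ρ}` for every centre `x'` and radius `r > 0`: the `j`-th
strip contributes at most `(a²τ⁴)ʲ P = (τʲ)^{2-2ρ} P` and at most
`T σ^{2j} |B_r| (a^{2j} sup|p̃[u]|)^{3/2} = C r³ (τʲ)^{-(1+2ρ)}`; `crossover_tsum_le` sums the two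
regimes. [folklore] -/
theorem exists_lintegral_cylinder_pressure_le (h : IsSuperBlock T ν₀ τ σ a z G u)
    (hρ : a = τ ^ (-(1 + ρ))) :
    ∃ C : ℝ, 0 ≤ C ∧ ∀ (x' : EuclideanSpace ℝ (Fin 3)) (r : ℝ), 0 < r →
      ∫⁻ q in (univ : Set ℝ) ×ˢ ball x' r,
          ‖normalisedPressure (glueG T σ τ a z u q.1) q.2‖ₑ ^ (3 / 2 : ℝ) ≤
        ENNReal.ofReal (C * r ^ (2 - 2 * ρ)) := by
  obtain ⟨Mp, hMp0, hMp⟩ := h.exists_bound_pressure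
  have hρ0 := h.powerExp_pos hρ
  have hρ1 := h.powerExp_lt_half hρ
  have hτ := h.τ_pos
  have hτ1 := h.τ_lt_one
  -- the constants
  set P : ℝ := (∫⁻ q in Ico 0 T ×ˢ (univ : Set (EuclideanSpace ℝ (Fin 3))),
    ‖normalisedPressure (u q.1) q.2‖ₑ ^ (3 / 2 : ℝ)).toReal with hP
  have hP0 : 0 ≤ P := ENNReal.toReal_nonneg
  have hPeq : ∫⁻ q in Ico 0 T ×ˢ (univ : Set (EuclideanSpace ℝ (Fin 3))),
      ‖normalisedPressure (u q.1) q.2‖ₑ ^ (3 / 2 : ℝ) = ENNReal.ofReal P :=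
    (ENNReal.ofReal_toReal h.base_lintegral_pressure_rpow_lt_top.ne).symm
  set V₁ : ℝ := (volume (ball (0 : EuclideanSpace ℝ (Fin 3)) 1)).toReal with hV₁
  have hV₁0 : 0 ≤ V₁ := ENNReal.toReal_nonneg
  set F : ℝ × EuclideanSpace ℝ (Fin 3) → ℝ≥0∞ := fun q =>
    ‖normalisedPressure (glueG T σ τ a z u q.1) q.2‖ₑ ^ (3 / 2 : ℝ) with hF
  refine ⟨P / (1 - τ ^ (2 - 2 * ρ)) + Mp ^ (3 / 2 : ℝ) * T * V₁ / (1 - τ ^ (1 + 2 * ρ)), ?_,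
    fun x' r hr => ?_⟩
  · have h1 : τ ^ (2 - 2 * ρ) < 1 := Real.rpow_lt_one hτ.le hτ1 (by linarith)
    have h2 : τ ^ (1 + 2 * ρ) < 1 := Real.rpow_lt_one hτ.le hτ1 (by linarith)
    have := h.T_pos
    have : 0 ≤ Mp ^ (3 / 2 : ℝ) := Real.rpow_nonneg hMp0 _
    exact add_nonneg (div_nonneg hP0 (by linarith)) (div_nonneg (by positivity) (by linarith))
  -- decomposition into strips
  have hmeas : MeasurableSet ((univ : Set ℝ) ×ˢ ball x' r) := MeasurableSet.univ.prod measurableSet_ball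
  have hH0 : ∀ q : ℝ × EuclideanSpace ℝ (Fin 3), q.1 ∉ Ico 0 (blowupTime T σ) →
      ((univ : Set ℝ) ×ˢ ball x' r).indicator F q = 0 := fun q hq =>
    indicator_apply_eq_zero.2 fun _ => by
      simp only [hF, h.glueG_eq_zero_of_notMem hq, normalisedPressure_zero, Pi.zero_apply, enorm_zero,
        ENNReal.zero_rpow_of_pos (by norm_num : (0 : ℝ) < 3 / 2)]
  have hsplit : ∫⁻ q in (univ : Set ℝ) ×ˢ ball x' r, F q =
      ∑' j : ℕ, ∫⁻ q in Ico (switchTime T σ j) (switchTime T σ (j + 1)) ×ˢ ball x' r, F q := by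
    rw [← lintegral_indicator hmeas, h.lintegral_eq_tsum_strip hH0]
    refine tsum_congr fun j => ?_
    rw [lintegral_indicator hmeas, Measure.restrict_restrict hmeas, prod_inter_prod, univ_inter,
      inter_univ]
  rw [hsplit]
  have hMp32 : 0 ≤ Mp ^ (3 / 2 : ℝ) := Real.rpow_nonneg hMp0 _
  refine crossover_tsum_le (e₁ := 2 - 2 * ρ) (e₂ := 1 + 2 * ρ) hτ hτ1 hr (by linarith) (by linarith)
    hP0 (by have := h.T_pos; positivity) (fun j => ?_) (fun j => ?_)
  · -- branch 1: the whole strip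
    calc ∫⁻ q in Ico (switchTime T σ j) (switchTime T σ (j + 1)) ×ˢ ball x' r, F q
        ≤ ∫⁻ q in Ico (switchTime T σ j) (switchTime T σ (j + 1)) ×ˢ
            (univ : Set (EuclideanSpace ℝ (Fin 3))), F q :=
          lintegral_mono_set (prod_mono Subset.rfl (subset_univ _))
      _ = ENNReal.ofReal (P * (τ ^ j) ^ (2 - 2 * ρ)) := by
          rw [hF, h.setLIntegral_strip_enorm_pressure_rpow j (by norm_num : (0 : ℝ) ≤ 3 / 2), hPeq,
            h.gain_pow_sq_rpow_three_halves, h.scalar_pressure,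
            ← ENNReal.ofReal_mul (pow_nonneg (mul_nonneg (sq_nonneg a) (pow_nonneg hτ.le 4)) _),
            h.gain_sq_mul_pow_four_eq_rpow hρ, ← pow_rpow_comm hτ.le, mul_comm]
  · -- branch 2: volume × sup
    have hj' : ∀ q ∈ Ico (switchTime T σ j) (switchTime T σ (j + 1)) ×ˢ ball x' r,
        F q ≤ ENNReal.ofReal (((a ^ j) ^ 2 * Mp) ^ (3 / 2 : ℝ)) := fun q hq => by
      simp only [hF]
      rw [← ofReal_norm, ENNReal.ofReal_rpow_of_nonneg (norm_nonneg _) (by norm_num)]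
      exact ENNReal.ofReal_le_ofReal (Real.rpow_le_rpow (norm_nonneg _)
        (h.norm_pressure_glueG_le_of_mem hMp (mem_prod.1 hq).1 q.2) (by norm_num))
    have hvol : volume (Ico (switchTime T σ j) (switchTime T σ (j + 1)) ×ˢ ball x' r) =
        ENNReal.ofReal (T * σ ^ (2 * j)) * (ENNReal.ofReal (r ^ 3) * ENNReal.ofReal V₁) := by
      rw [Measure.volume_eq_prod, Measure.prod_prod, Real.volume_Ico, switchTime_succ,
        add_sub_cancel_left, volume_ball_eq_ofReal_mul x' hr.le, hV₁,
        ENNReal.ofReal_toReal volume_unitBall_ne_top]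
    have hr3 : r ^ ((2 - 2 * ρ) + (1 + 2 * ρ)) = r ^ 3 := by
      rw [show (2 - 2 * ρ) + (1 + 2 * ρ) = ((3 : ℕ) : ℝ) by push_cast; ring, Real.rpow_natCast]
    have hcoef : ((a ^ j) ^ 2 * Mp) ^ (3 / 2 : ℝ) * σ ^ (2 * j) =
        (τ ^ j) ^ (-(1 + 2 * ρ)) * Mp ^ (3 / 2 : ℝ) := by
      have hτj : 0 < τ ^ j := pow_pos hτ j
      rw [Real.mul_rpow (sq_nonneg _) hMp0, h.gain_pow_sq_rpow_three_halves,
        h.σ_pow_two_mul_eq_rpow hρ j, h.gain_pow_eq_rpow hρ j, ← Real.rpow_mul_natCast hτj.le,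
        mul_right_comm, ← Real.rpow_add hτj]
      congr 2
      push_cast
      ring
    calc ∫⁻ q in Ico (switchTime T σ j) (switchTime T σ (j + 1)) ×ˢ ball x' r, F q
        ≤ ∫⁻ q in Ico (switchTime T σ j) (switchTime T σ (j + 1)) ×ˢ ball x' r,
            ENNReal.ofReal (((a ^ j) ^ 2 * Mp) ^ (3 / 2 : ℝ)) :=
          setLIntegral_mono' (measurableSet_Ico.prod measurableSet_ball) hj'
      _ = ENNReal.ofReal (((a ^ j) ^ 2 * Mp) ^ (3 / 2 : ℝ)) *
            volume (Ico (switchTime T σ j) (switchTime T σ (j + 1)) ×ˢ ball x' r) := setLIntegral_const _ _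
      _ = ENNReal.ofReal (Mp ^ (3 / 2 : ℝ) * T * V₁ *
            (r ^ ((2 - 2 * ρ) + (1 + 2 * ρ)) * (τ ^ j) ^ (-(1 + 2 * ρ)))) := by
          rw [hvol, hr3, ← ENNReal.ofReal_mul (pow_nonneg hr.le 3),
            ← ENNReal.ofReal_mul (mul_nonneg h.T_pos.le (pow_nonneg h.σ_pos.le _)),
            ← ENNReal.ofReal_mul (Real.rpow_nonneg (mul_nonneg (sq_nonneg _) hMp0) _),
            show ((a ^ j) ^ 2 * Mp) ^ (3 / 2 : ℝ) * (T * σ ^ (2 * j) * (r ^ 3 * V₁)) =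
              T * V₁ * r ^ 3 * (((a ^ j) ^ 2 * Mp) ^ (3 / 2 : ℝ) * σ ^ (2 * j)) by ring, hcoef]
          congr 1; ring

/-- **The power-weighted pressure gauge of the cascade is bounded at every centre and scale**:
`r^{2ρ} · D(r; z₀) ≤ C` with `D = cknD` (`r⁻² ∫∫_{Q_r(z₀)} |p|^{3/2}`) for `p = p̃[𝔲]` — Seregin's
third gauge (arXiv:2402.13229, (1.7)) for the NSI cascade. [folklore] -/
theorem exists_powerGaugeD_le (h : IsSuperBlock T ν₀ τ σ a z G u) (hρ : a = τ ^ (-(1 + ρ))) :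
    ∃ C : ℝ, 0 ≤ C ∧ ∀ (z₀ : ℝ × EuclideanSpace ℝ (Fin 3)) (r : ℝ), 0 < r →
      ENNReal.ofReal (r ^ (2 * ρ)) *
          cknD r z₀ (fun s => normalisedPressure (glueG T σ τ a z u s)) ≤ ENNReal.ofReal C := by
  obtain ⟨C, hC0, hC⟩ := h.exists_lintegral_cylinder_pressure_le hρ
  refine ⟨C, hC0, fun z₀ r hr => ?_⟩
  have hcyl : ∫⁻ q in parabolicCylinder r z₀,
      ‖normalisedPressure (glueG T σ τ a z u q.1) q.2‖ₑ ^ (3 / 2 : ℝ) ≤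
        ENNReal.ofReal (C * r ^ (2 - 2 * ρ)) :=
    (lintegral_mono_set (prod_mono (subset_univ _) Subset.rfl)).trans (hC z₀.2 r hr)
  calc ENNReal.ofReal (r ^ (2 * ρ)) * cknD r z₀ (fun s => normalisedPressure (glueG T σ τ a z u s))
      ≤ ENNReal.ofReal (r ^ (2 * ρ)) *
          ((ENNReal.ofReal r ^ 2)⁻¹ * ENNReal.ofReal (C * r ^ (2 - 2 * ρ))) :=
        mul_le_mul' le_rfl (mul_le_mul' le_rfl hcyl)
    _ = ENNReal.ofReal (r ^ (2 * ρ) * ((r ^ 2)⁻¹ * (C * r ^ (2 - 2 * ρ)))) := by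
        rw [← ENNReal.ofReal_pow hr.le, ← ENNReal.ofReal_inv_of_pos (pow_pos hr 2),
          ← ENNReal.ofReal_mul (inv_pos.2 (pow_pos hr 2)).le, ← ENNReal.ofReal_mul (by positivity)]
    _ = ENNReal.ofReal C := by
        congr 1
        rw [show r ^ (2 * ρ) * ((r ^ 2)⁻¹ * (C * r ^ (2 - 2 * ρ))) =
            C * (r ^ (2 * ρ) * r ^ (2 - 2 * ρ) * (r ^ 2)⁻¹) by ring, ← Real.rpow_add hr,
          show 2 * ρ + (2 - 2 * ρ) = ((2 : ℕ) : ℝ) by push_cast; ring, Real.rpow_natCast,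
          mul_inv_cancel₀ (pow_ne_zero 2 hr.ne'), mul_one]

/-- **(G3) in full for the cascade**: at every centre `z₀` and every scale `r > 0`,
`r^{2ρ} A(r; z₀) + r^{ρ} E(r; z₀) + r^{2ρ} D(r; z₀) ≤ M` for `𝔲`, its slice derivative and its
pressure `p̃[𝔲]` — the power-gauge hypothesis (1.7) of Seregin (arXiv:2402.13229) used by
`TypeIOrPowerZoomable` / `SereginZoomReduction` (there for `0 < r ≤ r₀` at the candidate point).
[folklore] -/
theorem exists_powerGauges_le (h : IsSuperBlock T ν₀ τ σ a z G u) (hρ : a = τ ^ (-(1 + ρ))) :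
    ∃ M : ℝ, 0 ≤ M ∧ ∀ (z₀ : ℝ × EuclideanSpace ℝ (Fin 3)) (r : ℝ), 0 < r →
      ENNReal.ofReal (r ^ (2 * ρ)) * cknA r z₀ (glueG T σ τ a z u) +
        ENNReal.ofReal (r ^ ρ) * cknE r z₀ (fun s x => fderiv ℝ (glueG T σ τ a z u s) x) +
        ENNReal.ofReal (r ^ (2 * ρ)) * cknD r z₀ (fun s => normalisedPressure (glueG T σ τ a z u s)) ≤
      ENNReal.ofReal M := by
  obtain ⟨CA, hCA0, hCA⟩ := h.exists_powerGaugeA_le hρ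
  obtain ⟨CE, hCE0, hCE⟩ := h.exists_powerGaugeE_le hρ
  obtain ⟨CD, hCD0, hCD⟩ := h.exists_powerGaugeD_le hρ
  refine ⟨CA + CE + CD, by positivity, fun z₀ r hr => ?_⟩
  rw [ENNReal.ofReal_add (add_nonneg hCA0 hCE0) hCD0, ENNReal.ofReal_add hCA0 hCE0]
  exact add_le_add (add_le_add (hCA z₀ r hr) (hCE z₀ r hr)) (hCD z₀ r hr)

end IsSuperBlock

end Summit.NavierStokesRegularity.NavierStokesRegularity.Theorems.TypeIliouvilleNoTypeIINegative

end
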